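import Literature.AlgebraicGeometry.Frobenioids.FiberProductsFrobenioid
import HarnessLib

/-!
# Frobenioids I, Proposition 1.6 (v): types of objects of `C ×_D D′` (the liftable clauses)
# (STEP-0 calibration fragment of the abc-iut cell — "routine verification" genre)

Mochizuki, *The geometry of Frobenioids I: the general theory*, Kyushu J. Math. **62** (2008)
293–400, §1, Proposition 1.6 (v), kurims text p. 28 [cite: MochizukiFrdI2008, Prop. 1.6]:

> "(v) A object of `C′` is Frobenius-trivial (respectively, quasi-Frobenius-trivial;
> sub-quasi-Frobenius-trivial; metrically trivial; base-trivial; perfect; group-like;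
> unit-trivial; Frobenius-normalized; isotropic; Frobenius-isotropic) if and only if it projects
> to such an object of `C`."

`FiberProducts.lean` proves the clauses Frobenius-trivial, group-like, isotropic; this file proves
quasi-Frobenius-trivial, sub-quasi-Frobenius-trivial, perfect, unit-trivial,
Frobenius-normalized, Frobenius-isotropic — all by lifting arrows of `C` with identity
`D′`-component and projecting arrows of `C′`. The clauses "metrically trivial" and
"base-trivial" (direction `C ⇒ C′`) are NOT proved here: the evident lifting needs an
isomorphism of the `C`-component with prescribed projection to `D` (see the module docstring of
`FiberProducts.lean`); they are left open. No statement of the paper is strengthened.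
-/

namespace Literature.AlgebraicGeometry.Frobenioids

open CategoryTheory Opposite

universe w v v' v'' u u' u''

namespace PreFrobenioid

variable {D : Type u} [Category.{v} D] {D' : Type u'} [Category.{v'} D']
  {Φ : Dᵒᵖ ⥤ CommMonCat.{w}} {C : Type u''} [Category.{v''} C]
  {F : C ⥤ ElemFrobenioid Φ} {G : D' ⥤ D}

namespace FiberProduct

/-! ### Endomorphisms of `(A, A′, α)` -/

/-- The projection `End_{C′}(A, A′, α) → End_C(A)` as a monoid homomorphism. [cite: MochizukiFrdI2008, Prop. 1.6] -/
def endFst (X : FiberProduct F G) : End X →* End X.fst where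
  toFun e := CFP.Hom.fst e
  map_one' := rfl
  map_mul' _ _ := rfl

/-- The projection `End_{C′}(A, A′, α) → End_{D′}(A′)` as a monoid homomorphism. [cite: MochizukiFrdI2008, Prop. 1.6] -/
def endSnd (X : FiberProduct F G) : End X →* End X.snd where
  toFun e := CFP.Hom.snd e
  map_one' := rfl
  map_mul' _ _ := rfl

/-- The lift `(φ₀, id)` of a base-identity endomorphism `φ₀` of `A` to `(A, A′, α)`.
[cite: MochizukiFrdI2008, Prop. 1.6] -/
def liftEnd (X : FiberProduct F G) (φ₀ : X.fst ⟶ X.fst) (h : IsBaseIdentity F φ₀) : X ⟶ X :=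
  ⟨φ₀, 𝟙 X.snd, by
    have h' : Base F φ₀ = 𝟙 _ := h
    show Base F φ₀ ≫ X.e.hom = X.e.hom ≫ G.map (𝟙 X.snd)
    rw [h', G.map_id, Category.id_comp, Category.comp_id]⟩

end FiberProduct

open FiberProduct

/-! ### Proposition 1.6 (v), continued -/

/-- **Prop. 1.6 (v)**, quasi-Frobenius-trivial objects. [cite: MochizukiFrdI2008, Prop. 1.6] -/
theorem isQuasiFrobeniusTrivial_fiberProduct_iff (X : FiberProduct F G) :
    IsQuasiFrobeniusTrivial (fiberProductFunctor F G) X ↔ IsQuasiFrobeniusTrivial F X.fst := by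
  constructor
  · intro h n
    obtain ⟨φ, hφ, hn⟩ := h n
    exact ⟨φ.fst, isBaseIdentity_fst_of_isBaseIdentity hφ, hn⟩
  · intro h n
    obtain ⟨φ₀, hφ₀, hn⟩ := h n
    exact ⟨liftEnd X φ₀ hφ₀, rfl, hn⟩

/-- **Prop. 1.6 (v)**, sub-quasi-Frobenius-trivial objects. [cite: MochizukiFrdI2008, Prop. 1.6] -/
theorem isSubQuasiFrobeniusTrivial_fiberProduct_iff (hF : IsFrobenioid F) (X : FiberProduct F G) :
    IsSubQuasiFrobeniusTrivial (fiberProductFunctor F G) X ↔ IsSubQuasiFrobeniusTrivial F X.fst := by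
  constructor
  · rintro ⟨Y, ψ, hco, hpre, hq⟩
    haveI : IsIso ψ.snd := hpre.2
    exact ⟨Y.fst, ψ.fst, (isCoAngular_fiberProduct_iff hF ψ).mp hco,
      (isPreStep_fiberProduct_iff ψ hpre.2).mp hpre, (isQuasiFrobeniusTrivial_fiberProduct_iff Y).mp hq⟩
  · rintro ⟨B, ψ₀, hco, hpre, hq⟩
    refine ⟨liftSrc X ψ₀ hpre.2, liftSrcHom X ψ₀ hpre.2,
      (isCoAngular_fiberProduct_iff hF _).mpr hco, ⟨hpre.1, show IsIso (𝟙 X.snd) from inferInstance⟩,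
      (isQuasiFrobeniusTrivial_fiberProduct_iff _).mpr hq⟩

/-- **Prop. 1.6 (v)**, unit-trivial objects (`O^×(A′) ≅ O^×(A)` elementwise). [cite: MochizukiFrdI2008, Prop. 1.6] -/
theorem isUnitTrivial_fiberProduct_iff (X : FiberProduct F G) :
    IsUnitTrivial (fiberProductFunctor F G) X ↔ IsUnitTrivial F X.fst := by
  constructor
  · intro h u hu
    have hub : Base F u.hom = 𝟙 _ := hu.1
    have w : Base F u.hom ≫ X.e.hom = X.e.hom ≫ G.map (𝟙 X.snd) := by
      rw [hub, G.map_id, Category.id_comp, Category.comp_id]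
    have hU := h (CFP.isoMk u (Iso.refl X.snd) w) (show _ ∧ _ from ⟨rfl, hu.2⟩)
    exact Iso.ext (congrArg (fun I : Aut X => CFP.Hom.fst I.hom) hU)
  · intro h U hU
    have hU1 : CFP.Hom.snd U.hom = 𝟙 X.snd := hU.1
    have hu : (CFP.proj₁ (baseFunctor F) G).mapIso U ∈ unitsSubgroup F X.fst :=
      ⟨isBaseIdentity_fst_of_isBaseIdentity hU.1, hU.2⟩
    have h₁ : CFP.Hom.fst U.hom = 𝟙 X.fst := congrArg Iso.hom (h _ hu)
    exact Iso.ext (CFP.hom_ext h₁ hU1)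

/-- **Prop. 1.6 (v)**, Frobenius-normalized objects. [cite: MochizukiFrdI2008, Prop. 1.6] -/
theorem isFrobeniusNormalized_fiberProduct_iff (X : FiberProduct F G) :
    IsFrobeniusNormalized (fiberProductFunctor F G) X ↔ IsFrobeniusNormalized F X.fst := by
  constructor
  · intro h φ₀ hφ₀ u hu
    let a : End X := liftEnd X (show X.fst ⟶ X.fst from u) hu.1
    have ha : a ∈ endSubmonoid (fiberProductFunctor F G) X := show _ ∧ _ from ⟨rfl, hu.2⟩
    have hC := h (liftEnd X φ₀ hφ₀) rfl a ha
    have hC' := congrArg CFP.Hom.fst hC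
    have hpow : CFP.Hom.fst (show X ⟶ X from a ^ (degFr F φ₀ : ℕ)) =
        (show X.fst ⟶ X.fst from u ^ (degFr F φ₀ : ℕ)) := by
      show endFst X (a ^ (degFr F φ₀ : ℕ)) = (endFst X a) ^ (degFr F φ₀ : ℕ)
      rw [map_pow]
    show φ₀ ≫ (show X.fst ⟶ X.fst from u ^ (degFr F φ₀ : ℕ)) = (show X.fst ⟶ X.fst from u) ≫ φ₀
    rw [← hpow]
    exact hC'
  · intro h φ hφ a ha
    have hu : endFst X a ∈ endSubmonoid F X.fst := ⟨isBaseIdentity_fst_of_isBaseIdentity ha.1, ha.2⟩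
    have hC := h φ.fst (isBaseIdentity_fst_of_isBaseIdentity hφ) (endFst X a) hu
    have hφ' : φ.snd = 𝟙 X.snd := hφ
    have ha' : endSnd X a = 1 := ha.1
    refine CFP.hom_ext ?_ ?_
    · show φ.fst ≫ endFst X (a ^ (degFr F φ.fst : ℕ)) = endFst X a ≫ φ.fst
      rw [map_pow]
      exact hC
    · show φ.snd ≫ endSnd X (a ^ (degFr F φ.fst : ℕ)) = endSnd X a ≫ φ.snd
      rw [map_pow, ha', one_pow, hφ']
      rfl

/-- **Prop. 1.6 (v)**, Frobenius-isotropic objects. [cite: MochizukiFrdI2008, Prop. 1.6] -/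
theorem isFrobeniusIsotropic_fiberProduct_iff (hF : IsFrobenioid F) (X : FiberProduct F G) :
    IsFrobeniusIsotropic (fiberProductFunctor F G) X ↔ IsFrobeniusIsotropic F X.fst := by
  constructor
  · rintro ⟨Y, φ, hφ, hY⟩
    exact ⟨Y.fst, φ.fst, (isFrobeniusType_fiberProduct_iff hF φ hφ.2).mp hφ,
      (isIsotropic_fiberProduct_iff Y).mp hY⟩
  · rintro ⟨B, φ₀, hφ₀, hB⟩
    exact ⟨liftTgt X φ₀ hφ₀.2, liftTgtHom X φ₀ hφ₀.2,
      (isFrobeniusType_fiberProduct_iff hF (liftTgtHom X φ₀ hφ₀.2)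
        (show IsIso (𝟙 X.snd) from inferInstance)).mpr hφ₀,
      (isIsotropic_fiberProduct_iff _).mpr hB⟩

/-- Objects of `C′` base-isomorphic in `C′` have base-isomorphic `C`-components.
[cite: MochizukiFrdI2008, Prop. 1.6] -/
theorem baseIsomorphic_fst {X Y : FiberProduct F G} (h : BaseIsomorphic (fiberProductFunctor F G) X Y) :
    BaseIsomorphic F X.fst Y.fst := by
  obtain ⟨j⟩ := h
  let j₀ : X.snd ≅ Y.snd := j
  exact ⟨X.e ≪≫ G.mapIso j₀ ≪≫ Y.e.symm⟩

/-- **Prop. 1.6 (v)**, perfect objects, direction `C ⇒ C′`. [cite: MochizukiFrdI2008, Prop. 1.6] -/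
theorem isPerfectObj_fiberProduct_of_fst (hF : IsFrobenioid F) (X : FiberProduct F G)
    (h : IsPerfectObj F X.fst) : IsPerfectObj (fiberProductFunctor F G) X := by
  have hD : IsTotallyEpimorphic D := hF.isPreFrobenioid.isTotallyEpimorphic_base
  intro n
  obtain ⟨h₁, h₂⟩ := h n
  refine ⟨fun Y hY => ?_, ?_⟩
  · obtain ⟨B₀, φ₀, hφ₀, hn⟩ := h₁ Y.fst (baseIsomorphic_fst hY)
    exact ⟨liftSrc Y φ₀ hφ₀.2, liftSrcHom Y φ₀ hφ₀.2,
      (isFrobeniusType_fiberProduct_iff hF (liftSrcHom Y φ₀ hφ₀.2)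
        (show IsIso (𝟙 Y.snd) from inferInstance)).mpr hφ₀, hn⟩
  · intro Y₁ Y₁' Y₂ Y₂' φ₁ φ₂ hY₁ hY₂ hφ₁ hn₁ hφ₂ hn₂ ψ' hψ'
    haveI : IsIso φ₁.snd := hφ₁.2
    haveI : IsIso φ₂.snd := hφ₂.2
    haveI : IsIso ψ'.snd := hψ'.2
    obtain ⟨ψ₀, ⟨hψ₀, hcomp⟩, huniq⟩ := h₂ φ₁.fst φ₂.fst (baseIsomorphic_fst hY₁) (baseIsomorphic_fst hY₂)
      ((isFrobeniusType_fiberProduct_iff hF φ₁ hφ₁.2).mp hφ₁) hn₁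
      ((isFrobeniusType_fiberProduct_iff hF φ₂ hφ₂.2).mp hφ₂) hn₂ ψ'.fst
      ((isPreStep_fiberProduct_iff ψ' hψ'.2).mp hψ')
    refine ⟨liftDom (φ₁ ≫ ψ') φ₂ ψ₀ hcomp, ⟨⟨hψ₀.1, ?_⟩, liftDom_comp (φ₁ ≫ ψ') φ₂ ψ₀ hcomp⟩, ?_⟩
    · show IsIso ((φ₁ ≫ ψ').snd ≫ inv φ₂.snd)
      haveI : IsIso (φ₁ ≫ ψ').snd := by
        show IsIso (φ₁.snd ≫ ψ'.snd)
        infer_instance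
      infer_instance
    · rintro χ ⟨hχ, hχcomp⟩
      haveI : IsIso χ.snd := hχ.2
      have hχfst : χ.fst = ψ₀ :=
        huniq χ.fst ⟨(isPreStep_fiberProduct_iff χ hχ.2).mp hχ, congrArg CFP.Hom.fst hχcomp⟩
      have hχsnd : χ.snd ≫ φ₂.snd = φ₁.snd ≫ ψ'.snd := congrArg CFP.Hom.snd hχcomp
      refine CFP.hom_ext hχfst ?_
      show χ.snd = (φ₁.snd ≫ ψ'.snd) ≫ inv φ₂.snd
      rw [← cancel_mono φ₂.snd, Category.assoc, IsIso.inv_hom_id, Category.comp_id, hχsnd]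

/-- **Prop. 1.6 (v)**, perfect objects, direction `C′ ⇒ C`. [cite: MochizukiFrdI2008, Prop. 1.6] -/
theorem isPerfectObj_fst_of_fiberProduct (hF : IsFrobenioid F) (X : FiberProduct F G)
    (h : IsPerfectObj (fiberProductFunctor F G) X) : IsPerfectObj F X.fst := by
  intro n
  obtain ⟨h₁, h₂⟩ := h n
  refine ⟨fun B hB => ?_, ?_⟩
  · obtain ⟨i⟩ := hB
    let Y : FiberProduct F G := ⟨B, X.snd, i.symm ≪≫ X.e⟩
    obtain ⟨Y₀, φ, hφ, hn⟩ := h₁ Y ⟨Iso.refl X.snd⟩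
    exact ⟨Y₀.fst, φ.fst, (isFrobeniusType_fiberProduct_iff hF φ hφ.2).mp hφ, hn⟩
  · intro B₁ B₁' B₂ B₂' φ₁ φ₂ hB₁ hB₂ hφ₁ hn₁ hφ₂ hn₂ ψ' hψ'
    obtain ⟨i₁⟩ := hB₁
    -- lift everything to `C′` over `X′ := X.snd` with identity `D′`-components
    let Y₁ : FiberProduct F G := ⟨B₁, X.snd, i₁.symm ≪≫ X.e⟩
    let Y₁' : FiberProduct F G := liftTgt Y₁ φ₁ hφ₁.2
    let φ₁' : Y₁ ⟶ Y₁' := liftTgtHom Y₁ φ₁ hφ₁.2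
    let Y₂' : FiberProduct F G := liftTgt Y₁' ψ' hψ'.2
    let ψ'' : Y₁' ⟶ Y₂' := liftTgtHom Y₁' ψ' hψ'.2
    let Y₂ : FiberProduct F G := liftSrc Y₂' φ₂ hφ₂.2
    let φ₂' : Y₂ ⟶ Y₂' := liftSrcHom Y₂' φ₂ hφ₂.2
    have hY₁ : BaseIsomorphic (fiberProductFunctor F G) X Y₁ := ⟨Iso.refl X.snd⟩
    have hY₂ : BaseIsomorphic (fiberProductFunctor F G) X Y₂ := ⟨Iso.refl X.snd⟩
    obtain ⟨ψ, ⟨hψ, hcomp⟩, huniq⟩ := h₂ φ₁' φ₂' hY₁ hY₂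
      ((isFrobeniusType_fiberProduct_iff hF φ₁' (show IsIso (𝟙 X.snd) from inferInstance)).mpr hφ₁) hn₁
      ((isFrobeniusType_fiberProduct_iff hF φ₂' (show IsIso (𝟙 X.snd) from inferInstance)).mpr hφ₂) hn₂
      ψ'' ⟨hψ'.1, show IsIso (𝟙 X.snd) from inferInstance⟩
    haveI : IsIso ψ.snd := hψ.2
    refine ⟨ψ.fst, ⟨(isPreStep_fiberProduct_iff ψ hψ.2).mp hψ, congrArg CFP.Hom.fst hcomp⟩, ?_⟩
    rintro χ ⟨hχ, hχcomp⟩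
    haveI : IsIso (Base F φ₁) := hφ₁.2
    haveI : IsIso (Base F φ₂) := hφ₂.2
    haveI : IsIso (Base F ψ') := hψ'.2
    have hb : Base F χ ≫ Base F φ₂ = Base F φ₁ ≫ Base F ψ' := by
      rw [← base_comp, ← base_comp, hχcomp]
    have w : Base F χ ≫ (Base F φ₂ ≫ inv (Base F ψ') ≫ inv (Base F φ₁) ≫ (i₁.inv ≫ X.e.hom)) =
        (i₁.inv ≫ X.e.hom) ≫ G.map (𝟙 X.snd) := by
      rw [← Category.assoc, hb, G.map_id, Category.comp_id]
      simp only [Category.assoc, IsIso.hom_inv_id_assoc]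
    let χ' : Y₁ ⟶ Y₂ := ⟨χ, 𝟙 X.snd, w⟩
    have hχ' : χ' = ψ := huniq χ' ⟨⟨hχ.1, show IsIso (𝟙 X.snd) from inferInstance⟩,
      CFP.hom_ext hχcomp (show 𝟙 X.snd ≫ 𝟙 X.snd = 𝟙 X.snd ≫ 𝟙 X.snd from rfl)⟩
    exact congrArg CFP.Hom.fst hχ'

/-- **Prop. 1.6 (v)**, perfect objects. [cite: MochizukiFrdI2008, Prop. 1.6] -/
theorem isPerfectObj_fiberProduct_iff (hF : IsFrobenioid F) (X : FiberProduct F G) :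
    IsPerfectObj (fiberProductFunctor F G) X ↔ IsPerfectObj F X.fst :=
  ⟨isPerfectObj_fst_of_fiberProduct hF X, isPerfectObj_fiberProduct_of_fst hF X⟩

end PreFrobenioid

end Literature.AlgebraicGeometry.Frobenioids
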